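import Mathlib
import Summits.ValiantsHypothesis.ValiantsHypothesis.Theorems.FifoMatchingNNDivisionHardNewtonDimension
import HarnessLib

/-!
# Route FifoMatching — crux `NNDivisionHard` (stmt-ValiantsHypothesis-21181): FACES AVOIDING UP TO `n / polylog n` ARBITRARY
# ARCS ARE HARD — the quasi-polynomial currency of the halving recursion pushed from `√n` to `n / (log₂ n)^{O_c(1)}`

`…ManyArcFaces.halvingFaces_exp_lower_bound` (✓ p832650) is parametric in the number of rounds `r`: for `|I| < 2^r` and
`2^r (n_E + 16) ≤ n` the face `NN_n^{¬I}` has `2^{m^{1/6}} ≤ L₊(NN_n^{¬I}) + 3r` for some `m > n/2^r − 2`.  Its landed currency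
`sqrtArcFaces_qp_hard` spent this at `(|I| + 1)² ≤ n` (so that `m ≳ √n`).  Since the target is only QUASI-POLYNOMIAL, `m` of
polylogarithmic size already suffices: `m > (log₂ n + c + 18)^{6(c+18)}` gives `2^{m^{1/6}} > 2^{(log₂ n + c + 18)^{c + 18}}`,
which absorbs `16((2n+1)(2^{(log₂ n + c)^c} + 2))² + 3r`.  Hence (the step (S/M) named by leafhand-6's census):

* `lt_rpow_sixth_of_pow_lt` — `t⁶ < m ⇒ t < m^{1/6}` (naturals, read in `ℝ`); `polylog_absorb` — eventually in `ℓ`,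
  `2((ℓ + c + 18)^{6(c+18)} + 3) ≤ ℓ^{6(c+18)+1}`;
* ★★ `polylogArcFaces_qp_hard` — **for every `c`, eventually in `n`: for every arc set `I` with
  `2 (|I| + 1) ((log₂ n + c + 18)^{6(c+18)} + 3) ≤ n` and every `L`, `L₊(NN_n^{¬I}) ≤ 16((2n+1)(L+2))² ⇒ 2^((log₂ n + c)^c) < L`;**
  ★★ `polylogArcFaces_qp_hard'` — the same with the hypothesis `(|I| + 1) (log₂ n)^k ≤ n` for some `k = k(c)`
  (`k = 6(c+18)+1`): **faces avoiding up to `n/(log₂ n)^{k} − 1` ARBITRARY arcs are quasi-polynomially hard;**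
* ★★ `polylogArcsGeneric_not_certificate_qp` — a cofactor whose outer face `top_{𝟙_{I^c}} h` is a single monomial for SOME arc
  set `I` with `2 (|I| + 1) ((log₂ n + c + 18)^{6(c+18)} + 3) ≤ n` is not a certificate (was: `(|I|+1)² ≤ n`,
  `…ManyArcFaces.sqrtArcsGeneric_not_certificate_qp`);
* ★★ `polylogNewtonDim_not_certificate_qp` / `polylogNewtonDim_not_certificate_qp'` — **cofactors whose Newton polytope has
  dimension `D` with `2 (D + 1) ((log₂ n + c + 18)^{6(c+18)} + 3) ≤ n`, resp. `(D + 1)(log₂ n)^k ≤ n`, are not certificates**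
  (was: `(D+1)² ≤ n`, `…NewtonDimension.newtonDim_not_certificate_qp`): CERTIFICATES HAVE NEWTON DIMENSION `≥ n/(log₂ n)^{k(c)}`.

HONEST FRAMING: currency book-keeping for ONE crux (the thresholds of three landed tiers move from `√n` to `n/polylog n`);
stmt-21181 stays OPEN; nothing here bears on `NNNotVP` or on VP ≠ VNP (NOT proved).  No definitions, no named facts.
References: Hrubeš–Yehudayoff 2021 §6 Problem 2 [HrubesYehudayoff2021]; Jukna–Seiwert–Sergeev 2022 Thm 1
[JuknaSeiwertSergeev2022].
-/

noncomputable section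

-- Sub = Summit single-conjunct layout: the duplicated namespace component is mandated by the tree.
set_option linter.dupNamespace false
set_option autoImplicit false

namespace Summit.ValiantsHypothesis.ValiantsHypothesis.Theorems.FifoMatching.NNDivisionHard.PolylogArcFaces

open Finset MvPolynomial Literature.Computability.AlgebraicComplexity
open Summit.ValiantsHypothesis.ValiantsHypothesis.Theorems.ZeroOneTransfer.Negative (topComponent)
open Summit.ValiantsHypothesis.ValiantsHypothesis.Theorems.FifoMatching.NNDivisionHard.ManyArcFaces
  (halvingFaces_exp_lower_bound pow_add_three_mul_le add_le_mul_of_two_le)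
open Summit.ValiantsHypothesis.ValiantsHypothesis.Theorems.FifoMatching.NNDivisionHard.BinomialPowers
  (absorb_arith absorb_exp)
open Summit.ValiantsHypothesis.ValiantsHypothesis.Theorems.FifoMatching.NNDivisionHard.FewArcsAvoidable
  (exists_nestFree_avoiding_of_card_le)
open Summit.ValiantsHypothesis.ValiantsHypothesis.Theorems.FifoMatching.NNDivisionHard.ArcElimination
  (complexity_avoidingFace_le_of_top_monomial)
open Summit.ValiantsHypothesis.ValiantsHypothesis.Theorems.FifoMatching.NNDivisionHard.NewtonDimension
  (complexity_face_le_of_newtonDim)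
open scoped NNReal BigOperators

/-! ### §1 Arithmetic -/

/-- `t⁶ < m ⇒ t < m^{1/6}`. [folklore] -/
theorem lt_rpow_sixth_of_pow_lt {t m : ℕ} (h : t ^ 6 < m) : (t : ℝ) < (m : ℝ) ^ ((1 : ℝ) / 6) := by
  by_contra hle
  push Not at hle
  have hm0 : (0 : ℝ) ≤ (m : ℝ) := Nat.cast_nonneg m
  have h1 : (m : ℝ) ≤ (t : ℝ) ^ 6 := by
    calc (m : ℝ) = ((m : ℝ) ^ ((1 : ℝ) / 6)) ^ (6 : ℕ) := by
          rw [← Real.rpow_natCast, ← Real.rpow_mul hm0]; norm_num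
      _ ≤ (t : ℝ) ^ 6 := pow_le_pow_left₀ (Real.rpow_nonneg hm0 _) hle 6
  have h2 : m ≤ t ^ 6 := by exact_mod_cast h1
  omega

/-- Eventually in `ℓ`: `2((ℓ + c + 18)^{6(c+18)} + 3) ≤ ℓ^{6(c+18)+1}` (one more logarithm absorbs the constants). [folklore] -/
theorem polylog_absorb (c : ℕ) : ∃ l₀ : ℕ, ∀ l : ℕ, l₀ ≤ l →
    2 * ((l + (c + 18)) ^ (6 * (c + 18)) + 3) ≤ l ^ (6 * (c + 18) + 1) := by
  set P := 6 * (c + 18) with hP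
  refine ⟨2 ^ (P + 1) + 6 + (c + 18), fun l hl => ?_⟩
  have hlc : c + 18 ≤ l := le_trans (Nat.le_add_left _ _) hl
  have hl6 : 2 ^ (P + 1) + 6 ≤ l := by omega
  have h1 : (l + (c + 18)) ^ P ≤ (2 * l) ^ P := Nat.pow_le_pow_left (by omega) P
  have h2 : (2 * l) ^ P = 2 ^ P * l ^ P := mul_pow 2 l P
  have hlP : 1 ≤ l ^ P := Nat.one_le_pow _ _ (by omega)
  have h4 : (2 ^ (P + 1) + 6) * l ^ P ≤ l * l ^ P := Nat.mul_le_mul_right _ hl6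
  calc 2 * ((l + (c + 18)) ^ P + 3) ≤ 2 * (2 ^ P * l ^ P + 3) :=
        Nat.mul_le_mul_left 2 (Nat.add_le_add_right (h1.trans h2.le) 3)
    _ = 2 ^ (P + 1) * l ^ P + 6 := by ring
    _ ≤ 2 ^ (P + 1) * l ^ P + 6 * l ^ P := Nat.add_le_add_left (Nat.le_mul_of_pos_right 6 (by omega)) _
    _ = (2 ^ (P + 1) + 6) * l ^ P := by ring
    _ ≤ l * l ^ P := h4
    _ = l ^ (P + 1) := by ring

/-! ### §2 Faces avoiding up to `n / polylog n` arbitrary arcs -/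

variable {n : ℕ}

/-- ★★ **FACES AVOIDING UP TO `n / polylog n` ARCS, quasi-polynomial currency.**  For every `c`, eventually in `n`: for every
arc set `I` with `2 (|I| + 1) ((log₂ n + c + 18)^{6(c+18)} + 3) ≤ n` and every `L`,
`L₊(NN_n^{¬I}) ≤ 16 ((2n+1)(L+2))² ⇒ 2^((log₂ n + c)^c) < L`. [cite: HrubesYehudayoff2021, §6 Problem 2] -/
theorem polylogArcFaces_qp_hard (c : ℕ) : ∃ n₀ : ℕ, ∀ n : ℕ, n₀ ≤ n →
    ∀ I : Finset (Fin (2 * n) × Fin (2 * n)),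
      2 * (I.card + 1) * ((Nat.log 2 n + (c + 18)) ^ (6 * (c + 18)) + 3) ≤ n → ∀ L : ℕ,
    complexity (∑ M ∈ (nestFreeMatchings (2 * n)).filter (fun M => ∀ j ∈ openers M, (j, M j) ∉ I),
      arcMonomial ℝ≥0 M) ≤ 16 * ((2 * n + 1) * (L + 2)) ^ 2 → 2 ^ ((Nat.log 2 n + c) ^ c) < L := by
  set K : ℕ := c + 14 with hK
  obtain ⟨nE, hrec⟩ := halvingFaces_exp_lower_bound
  refine ⟨max (2 ^ (nE + 16)) 2, fun n hn I hI L hface => ?_⟩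
  have hn1 : 2 ^ (nE + 16) ≤ n := le_trans (le_max_left _ _) hn
  have hn2 : 2 ≤ n := le_trans (le_max_right _ _) hn
  set F := complexity (∑ M ∈ (nestFreeMatchings (2 * n)).filter (fun M => ∀ j ∈ openers M, (j, M j) ∉ I),
      arcMonomial ℝ≥0 M) with hF
  -- the polylog of the hypothesis is `T⁶`, `T = (log₂ n + K + 4)^(K + 4)`
  have hT6 : (Nat.log 2 n + (c + 18)) ^ (6 * (c + 18)) = ((Nat.log 2 n + (K + 4)) ^ (K + 4)) ^ 6 := by
    rw [← pow_mul, hK, show c + 14 + 4 = c + 18 by ring, Nat.mul_comm]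
  -- the number of rounds: `|I| < 2^r ≤ 2 (|I| + 1)`
  set r : ℕ := Nat.log 2 (I.card + 1) + 1 with hr
  have hr1 : I.card + 1 < 2 ^ r := Nat.lt_pow_succ_log_self one_lt_two _
  have hr2 : 2 ^ r ≤ 2 * (I.card + 1) := by
    rw [hr, pow_succ]
    have := Nat.pow_log_le_self 2 (show I.card + 1 ≠ 0 by omega)
    omega
  -- size condition `2^r (nE + 16) ≤ n`: the polylog exceeds `nE + 16` because `log₂ n ≥ nE + 16`
  have hlog : nE + 16 ≤ Nat.log 2 n := (Nat.le_log_iff_pow_le one_lt_two (by omega)).2 hn1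
  have hpoly : nE + 16 ≤ (Nat.log 2 n + (c + 18)) ^ (6 * (c + 18)) + 3 := by
    have h1 : Nat.log 2 n ≤ (Nat.log 2 n + (c + 18)) ^ (6 * (c + 18)) :=
      calc Nat.log 2 n ≤ Nat.log 2 n + (c + 18) := Nat.le_add_right _ _
        _ = (Nat.log 2 n + (c + 18)) ^ 1 := (pow_one _).symm
        _ ≤ (Nat.log 2 n + (c + 18)) ^ (6 * (c + 18)) := Nat.pow_le_pow_right (by omega) (by omega)
    omega
  have hsize : 2 ^ r * (nE + 16) ≤ n :=
    calc 2 ^ r * (nE + 16) ≤ 2 * (I.card + 1) * ((Nat.log 2 n + (c + 18)) ^ (6 * (c + 18)) + 3) :=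
          Nat.mul_le_mul hr2 hpoly
      _ ≤ n := hI
  obtain ⟨m, hm, hexp⟩ := hrec r n hsize I (by omega)
  -- `m > T⁶`
  have hmT : ((Nat.log 2 n + (K + 4)) ^ (K + 4)) ^ 6 < m := by
    rw [← hT6]
    have h1 : n < 2 * (I.card + 1) * (m + 2) := lt_of_lt_of_le hm (Nat.mul_le_mul_right _ hr2)
    have h2 : 2 * (I.card + 1) * ((Nat.log 2 n + (c + 18)) ^ (6 * (c + 18)) + 3) <
        2 * (I.card + 1) * (m + 2) := lt_of_le_of_lt hI h1
    have h3 := Nat.lt_of_mul_lt_mul_left h2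
    omega
  have h2 : (((Nat.log 2 n + (K + 4)) ^ (K + 4) : ℕ) : ℝ) < (m : ℝ) ^ ((1 : ℝ) / 6) :=
    lt_rpow_sixth_of_pow_lt hmT
  -- `3r ≤ 3 (log₂ n + 1)`
  have hr3 : r ≤ Nat.log 2 n + 1 := by
    rw [hr]
    have h0 : 2 * (I.card + 1) ≤ 2 * (I.card + 1) * ((Nat.log 2 n + (c + 18)) ^ (6 * (c + 18)) + 3) :=
      Nat.le_mul_of_pos_right _ (by omega)
    have h1 : I.card + 1 ≤ n := by omega
    have : Nat.log 2 (I.card + 1) ≤ Nat.log 2 n := Nat.log_mono_right h1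
    omega
  by_contra hle
  push Not at hle
  have e1 := absorb_arith n c L hle
  have e3 : 2 ^ (2 * (Nat.log 2 n + c) ^ c + 2 * Nat.log 2 n + 13) ≤ 2 ^ ((Nat.log 2 n + K) ^ K) :=
    Nat.pow_le_pow_right (by norm_num) (absorb_exp (Nat.log 2 n) c)
  have h7 := e1.trans e3
  -- `(ℓ + K)^K + 3r + 2 ≤ (ℓ + K + 4)^(K + 4)`
  have hp : (Nat.log 2 n + K) ^ K + 3 * r + 2 ≤ (Nat.log 2 n + (K + 4)) ^ (K + 4) := by
    have hx : 1 ≤ Nat.log 2 n + K := by omega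
    have h1 := pow_add_three_mul_le (Nat.log 2 n + K) K hx (by omega)
    have ha : (Nat.log 2 n + K + 3) ^ (K + 1) ≤ (Nat.log 2 n + (K + 4)) ^ (K + 1) :=
      Nat.pow_le_pow_left (by omega) _
    have hc3 : 3 ≤ (Nat.log 2 n + (K + 4)) ^ 3 :=
      calc 3 ≤ 3 ^ 1 := by norm_num
        _ ≤ (Nat.log 2 n + (K + 4)) ^ 1 := Nat.pow_le_pow_left (by omega) 1
        _ ≤ (Nat.log 2 n + (K + 4)) ^ 3 := Nat.pow_le_pow_right (by omega) (by norm_num)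
    have h2 : (Nat.log 2 n + (K + 4)) ^ (K + 1) * 3 ≤ (Nat.log 2 n + (K + 4)) ^ (K + 4) :=
      calc (Nat.log 2 n + (K + 4)) ^ (K + 1) * 3
          ≤ (Nat.log 2 n + (K + 4)) ^ (K + 1) * (Nat.log 2 n + (K + 4)) ^ 3 := Nat.mul_le_mul_left _ hc3
        _ = (Nat.log 2 n + (K + 4)) ^ (K + 4) := by rw [← pow_add]
    have h3 : 3 * r ≤ 3 * (Nat.log 2 n + K) := by omega
    omega
  -- abbreviate the big quantities
  obtain ⟨X, hX⟩ : ∃ X : ℕ, ((2 * n + 1) * (L + 2)) ^ 2 = X := ⟨_, rfl⟩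
  obtain ⟨P, hP⟩ : ∃ P : ℕ, 2 ^ ((Nat.log 2 n + K) ^ K) = P := ⟨_, rfl⟩
  obtain ⟨Q, hQ⟩ : ∃ Q : ℕ, 2 ^ (3 * r + 2) = Q := ⟨_, rfl⟩
  have hX1 : 1 ≤ X := by
    rw [← hX]; exact Nat.one_le_pow _ _ (Nat.mul_pos (by omega) (by omega))
  rw [hX, hP] at h7
  rw [hX] at hface
  have hP2 : 2 ≤ P := by omega
  have hQ2 : 2 ≤ Q := by
    rw [← hQ]
    calc 2 = 2 ^ 1 := (pow_one 2).symm
      _ ≤ 2 ^ (3 * r + 2) := Nat.pow_le_pow_right (by norm_num) (by omega)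
  have hQr : 3 * r + 1 ≤ Q := by
    rw [← hQ]
    have := Nat.lt_two_pow_self (n := 3 * r + 2)
    omega
  have key : P + Q ≤ P * Q := add_le_mul_of_two_le P Q hP2 hQ2
  have h8 : 16 * X + 3 * r + 1 ≤ 2 ^ ((Nat.log 2 n + (K + 4)) ^ (K + 4)) :=
    calc 16 * X + 3 * r + 1 ≤ P + Q := by omega
      _ ≤ P * Q := key
      _ = 2 ^ ((Nat.log 2 n + K) ^ K + 3 * r + 2) := by rw [← hP, ← hQ]; ring
      _ ≤ 2 ^ ((Nat.log 2 n + (K + 4)) ^ (K + 4)) := Nat.pow_le_pow_right (by norm_num) hp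
  have h3 : (2 : ℝ) ^ ((((Nat.log 2 n + (K + 4)) ^ (K + 4) : ℕ) : ℝ)) < (2 : ℝ) ^ ((m : ℝ) ^ ((1 : ℝ) / 6)) :=
    Real.rpow_lt_rpow_of_exponent_lt (by norm_num) h2
  have h4 : ((2 ^ ((Nat.log 2 n + (K + 4)) ^ (K + 4)) : ℕ) : ℝ) < ((F + 3 * r : ℕ) : ℝ) := by
    rw [Nat.cast_pow, Nat.cast_ofNat, ← Real.rpow_natCast]
    exact h3.trans_le hexp
  have h5 : 2 ^ ((Nat.log 2 n + (K + 4)) ^ (K + 4)) < F + 3 * r := by exact_mod_cast h4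
  have h9 : F + 3 * r < 16 * X + 3 * r + 1 := by omega
  exact absurd (lt_trans h5 (lt_of_lt_of_le h9 h8)) (lt_irrefl _)

/-- ★★ **The same, `∃ k` form: faces avoiding up to `n/(log₂ n)^k − 1` ARBITRARY arcs are quasi-polynomially hard** —
for every `c` there are `k` (`= 6(c+18)+1`) and `n₀` with: for all `n ≥ n₀`, every arc set `I` with `(|I| + 1)(log₂ n)^k ≤ n`
and every `L`, `L₊(NN_n^{¬I}) ≤ 16 ((2n+1)(L+2))² ⇒ 2^((log₂ n + c)^c) < L`. [cite: HrubesYehudayoff2021, §6 Problem 2] -/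
theorem polylogArcFaces_qp_hard' (c : ℕ) : ∃ k n₀ : ℕ, ∀ n : ℕ, n₀ ≤ n →
    ∀ I : Finset (Fin (2 * n) × Fin (2 * n)), (I.card + 1) * (Nat.log 2 n) ^ k ≤ n → ∀ L : ℕ,
    complexity (∑ M ∈ (nestFreeMatchings (2 * n)).filter (fun M => ∀ j ∈ openers M, (j, M j) ∉ I),
      arcMonomial ℝ≥0 M) ≤ 16 * ((2 * n + 1) * (L + 2)) ^ 2 → 2 ^ ((Nat.log 2 n + c) ^ c) < L := by
  obtain ⟨n₀, hn₀⟩ := polylogArcFaces_qp_hard c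
  obtain ⟨l₀, hl₀⟩ := polylog_absorb c
  refine ⟨6 * (c + 18) + 1, max n₀ (2 ^ l₀), fun n hn I hI L hface =>
    hn₀ n (le_trans (le_max_left _ _) hn) I ?_ L hface⟩
  have hn' : 2 ^ l₀ ≤ n := le_trans (le_max_right _ _) hn
  have hl : l₀ ≤ Nat.log 2 n :=
    (Nat.le_log_iff_pow_le one_lt_two (by have := Nat.one_le_two_pow (n := l₀); omega)).2 hn'
  calc 2 * (I.card + 1) * ((Nat.log 2 n + (c + 18)) ^ (6 * (c + 18)) + 3)
      = (I.card + 1) * (2 * ((Nat.log 2 n + (c + 18)) ^ (6 * (c + 18)) + 3)) := by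
        rw [Nat.mul_comm 2 (I.card + 1), Nat.mul_assoc]
    _ ≤ (I.card + 1) * (Nat.log 2 n) ^ (6 * (c + 18) + 1) := Nat.mul_le_mul_left _ (hl₀ _ hl)
    _ ≤ n := hI

/-! ### §3 Two tiers re-priced: arc-generic cofactors and low Newton dimension up to `n / polylog n` -/

/-- ★★ **COFACTORS GENERIC FOR SOME ARC SET OF SIZE UP TO `n / polylog n` ARE NOT CERTIFICATES.**  For every `c`, eventually in
`n`: if for some arc set `I` with `2 (|I| + 1) ((log₂ n + c + 18)^{6(c+18)} + 3) ≤ n` the outer face `top_{𝟙_{I^c}} h` is a single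
monomial `a · x^d` (`a ≠ 0`), then `2^((log₂ n + c)^c) < L₊(NN_n · h) + L₊(h)`.
[cite: HrubesYehudayoff2021, §6 Problem 2] [cite: JuknaSeiwertSergeev2022, Thm 1] -/
theorem polylogArcsGeneric_not_certificate_qp (c : ℕ) : ∃ n₀ : ℕ, ∀ n : ℕ, n₀ ≤ n →
    ∀ I : Finset (Fin (2 * n) × Fin (2 * n)),
      2 * (I.card + 1) * ((Nat.log 2 n + (c + 18)) ^ (6 * (c + 18)) + 3) ≤ n →
    ∀ (h : MvPolynomial (Fin (2 * n) × Fin (2 * n)) ℝ≥0) (d : (Fin (2 * n) × Fin (2 * n)) →₀ ℕ) (a : ℝ≥0), a ≠ 0 →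
      topComponent (fun v : Fin (2 * n) × Fin (2 * n) => if v ∈ I then 0 else 1) h = monomial d a →
      2 ^ ((Nat.log 2 n + c) ^ c) < complexity (nestFreeMatchingPoly n ℝ≥0 * h) + complexity h := by
  obtain ⟨n₀, hn₀⟩ := polylogArcFaces_qp_hard c
  refine ⟨n₀, fun n hn I hI h d a ha htop => ?_⟩
  have hcard : 2 * I.card + 3 ≤ n := by
    have h3 : 2 * (I.card + 1) * 3 ≤ 2 * (I.card + 1) * ((Nat.log 2 n + (c + 18)) ^ (6 * (c + 18)) + 3) :=
      Nat.mul_le_mul_left _ (by omega)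
    omega
  have hIav := exists_nestFree_avoiding_of_card_le (k := I.card) (c := n) hcard I le_rfl
  have hface := complexity_avoidingFace_le_of_top_monomial I hIav ha htop
  exact lt_of_lt_of_le (hn₀ n hn I hI _ hface) (Nat.le_add_right _ _)

/-- ★★ **COFACTORS OF NEWTON DIMENSION UP TO `n / polylog n` ARE NOT CERTIFICATES.**  For every `c`, eventually in `n`: every
`h ≠ 0` whose support spans an affine space of dimension `D` with `2 (D + 1) ((log₂ n + c + 18)^{6(c+18)} + 3) ≤ n` satisfies
`2^((log₂ n + c)^c) < L₊(NN_n · h) + L₊(h)`. [cite: HrubesYehudayoff2021, §6 Problem 2] [cite: JuknaSeiwertSergeev2022, Thm 1] -/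
theorem polylogNewtonDim_not_certificate_qp (c : ℕ) : ∃ n₀ : ℕ, ∀ n : ℕ, n₀ ≤ n →
    ∀ h : MvPolynomial (Fin (2 * n) × Fin (2 * n)) ℝ≥0, h ≠ 0 →
      2 * (Module.finrank ℚ (vectorSpan ℚ ((fun u : (Fin (2 * n) × Fin (2 * n)) →₀ ℕ =>
        fun a : Fin (2 * n) × Fin (2 * n) => (u a : ℚ)) '' (h.support : Set ((Fin (2 * n) × Fin (2 * n)) →₀ ℕ))))
        + 1) * ((Nat.log 2 n + (c + 18)) ^ (6 * (c + 18)) + 3) ≤ n →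
      2 ^ ((Nat.log 2 n + c) ^ c) < complexity (nestFreeMatchingPoly n ℝ≥0 * h) + complexity h := by
  obtain ⟨n₀, hn₀⟩ := polylogArcFaces_qp_hard c
  refine ⟨max n₀ 3, fun n hn h hh hD => ?_⟩
  have hn3 : 3 ≤ n := le_trans (le_max_right _ _) hn
  obtain ⟨I, hIcard, -, hface⟩ := complexity_face_le_of_newtonDim hn3 hh
  have hI : 2 * (I.card + 1) * ((Nat.log 2 n + (c + 18)) ^ (6 * (c + 18)) + 3) ≤ n :=
    le_trans (Nat.mul_le_mul_right _ (Nat.mul_le_mul_left 2 (Nat.add_le_add_right hIcard 1))) hD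
  exact lt_of_lt_of_le (hn₀ n (le_trans (le_max_left _ _) hn) I hI _ hface) (Nat.le_add_right _ _)

/-- ★★ **The same, `∃ k` form: CERTIFICATES HAVE NEWTON DIMENSION `≥ n/(log₂ n)^k`** — for every `c` there are `k` and `n₀`
with: for all `n ≥ n₀`, every `h ≠ 0` with `(dim Newt(h) + 1)(log₂ n)^k ≤ n` satisfies `2^((log₂ n + c)^c) < L₊(NN_n · h) + L₊(h)`.
[cite: HrubesYehudayoff2021, §6 Problem 2] -/
theorem polylogNewtonDim_not_certificate_qp' (c : ℕ) : ∃ k n₀ : ℕ, ∀ n : ℕ, n₀ ≤ n →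
    ∀ h : MvPolynomial (Fin (2 * n) × Fin (2 * n)) ℝ≥0, h ≠ 0 →
      (Module.finrank ℚ (vectorSpan ℚ ((fun u : (Fin (2 * n) × Fin (2 * n)) →₀ ℕ =>
        fun a : Fin (2 * n) × Fin (2 * n) => (u a : ℚ)) '' (h.support : Set ((Fin (2 * n) × Fin (2 * n)) →₀ ℕ))))
        + 1) * (Nat.log 2 n) ^ k ≤ n →
      2 ^ ((Nat.log 2 n + c) ^ c) < complexity (nestFreeMatchingPoly n ℝ≥0 * h) + complexity h := by
  obtain ⟨n₀, hn₀⟩ := polylogNewtonDim_not_certificate_qp c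
  obtain ⟨l₀, hl₀⟩ := polylog_absorb c
  refine ⟨6 * (c + 18) + 1, max n₀ (2 ^ l₀), fun n hn h hh hD => hn₀ n (le_trans (le_max_left _ _) hn) h hh ?_⟩
  have hn' : 2 ^ l₀ ≤ n := le_trans (le_max_right _ _) hn
  have hl : l₀ ≤ Nat.log 2 n :=
    (Nat.le_log_iff_pow_le one_lt_two (by have := Nat.one_le_two_pow (n := l₀); omega)).2 hn'
  set D := Module.finrank ℚ (vectorSpan ℚ ((fun u : (Fin (2 * n) × Fin (2 * n)) →₀ ℕ =>
        fun a : Fin (2 * n) × Fin (2 * n) => (u a : ℚ)) '' (h.support : Set ((Fin (2 * n) × Fin (2 * n)) →₀ ℕ))))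
    with hDdef
  calc 2 * (D + 1) * ((Nat.log 2 n + (c + 18)) ^ (6 * (c + 18)) + 3)
      = (D + 1) * (2 * ((Nat.log 2 n + (c + 18)) ^ (6 * (c + 18)) + 3)) := by
        rw [Nat.mul_comm 2 (D + 1), Nat.mul_assoc]
    _ ≤ (D + 1) * (Nat.log 2 n) ^ (6 * (c + 18) + 1) := Nat.mul_le_mul_left _ (hl₀ _ hl)
    _ ≤ n := hD

end Summit.ValiantsHypothesis.ValiantsHypothesis.Theorems.FifoMatching.NNDivisionHard.PolylogArcFaces

end
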